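import Literature.AnabelianGeometry.EtaleTheta.Discharge.Sec5OfBiKummerDataKummer

/-!
# [EtTh] Prop. 4.3 (iii) / §5 p.331: the Kummer-torsion computation for §5 data over a MODEL Frobenioid, GENERIC form (pp. 317, 331 / PDF pp. 91, 105)

Mochizuki, *The étale theta function …*, Publ. RIMS **45** (2009)
[cite: MochizukiEtTh2009, Prop 4.3 (iii) p.317 (PDF p.91); §5 p.331 (PDF p.105)].  Seat abc-iut-L2-t4 (§5 owner), W3-L2-01,
PROOF-ONLY.  `Discharge/Sec5OfBiKummerDataKummer.lean` (p418152) proved `BiKummerDifferenceMem` (Prop. 4.3 (iii): the bi-Kummer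
difference `s^⊓-gp_N(h)·s^⊔-gp_N(h)⁻¹` is `μ_N(B_N)`-valued) for the assembled data `ofBiKummerData`, whose tempered groups come
from ONE §2 datum `ThetaEnvData N`.  The computation itself uses only: the category is a model Frobenioid ([FrdI] Thm. 5.2, `Φ`
divisorial, `B` group-like), the two defining relations of p.331 (PDF p.105) (`SgpCapSpec`, `SgpCupSpec`), the section property of
`s^trv_N` ([FrdI] Prop. 5.6), and the Kummer input "the root `f_N = s^⊓_N·(s^⊔_N)⁻¹` has `f_N^N` fixed by `s^trv_N(h')` for
`h' ∈ H_{A_N}`" (Def. 4.1 (iii) saturation / `H_{A_N}`-fixedness).  This file states it in exactly that generality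
(`pow_N_eq_one_of_root`, `biKummerDifferenceMem_of_root`) for ANY §5 data `𝔉` over `ModelFrobenioid Φ B Div_B` with
`𝔉.pre = PreFrobenioidData.ofModel …` (abc-iut-L2-d4's `h𝔉` convention, `Discharge/Sec5ModelCase.lean`), so that it applies
level-wise to the TOWER assembled from a family of roots (`FrobenioidThetaTowerOfBiKummerFamily.lean`), whose levels carry no
`ThetaEnvData`.  HONEST FRAMING: kernel-checked implications; nothing of [EtTh] is asserted unconditionally; no side taken downstream.
-/

noncomputable section

namespace Literature.AnabelianGeometry.EtaleTheta

open CategoryTheory Opposite Literature.AlgebraicGeometry.Frobenioids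
open Literature.AlgebraicGeometry.Frobenioids.PreFrobenioid (pull_injective)

universe w v v' u u'

namespace ThetaFrobenioid

variable {D : Type u} [Category.{v} D] {Φ B : Dᵒᵖ ⥤ CommMonCat.{w}} {DivB : B ⟶ monoidGp Φ}
  (𝔉 : ThetaFrobenioid.{w} (ModelFrobenioid Φ B DivB) D)

/-- For §5 data over a model Frobenioid, a unit `u ∈ O^×(B_N)` is a model unit (`Base = id`, `deg_Fr = 1`), [FrdI] Thm. 5.2 (ii).
[cite: MochizukiFrdI2008, Thm. 5.2 (ii) p.101] -/
theorem mem_modelUnits_of_mem_units (h𝔉 : 𝔉.pre = PreFrobenioidData.ofModel Φ B DivB) {u : Aut 𝔉.BN}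
    (hu : u ∈ 𝔉.units 𝔉.BN) : u ∈ ModelFrobenioid.units 𝔉.BN := by
  have : u ∈ 𝔉.pre.unitsSubgroup 𝔉.BN := hu
  rw [h𝔉] at this
  exact this

/-- **The Kummer-torsion computation, generic form** (Prop. 4.3 (iii), p.317 (PDF p.91), "follows immediately from the
definitions"; for the bi-Kummer root `(s^⊓-gp_N, s^⊔-gp_N)` of p.331 (PDF p.105)): for §5 data over a model Frobenioid satisfying
the defining relations `SgpCapSpec`, `SgpCupSpec` and the section property of `s^trv_N`, if `x` is the rational function of the root
(`x · u_{s^⊔_N} = u_{s^⊓_N}`, i.e. `f_N = s^⊓_N·(s^⊔_N)⁻¹` read through the [FrdI] Thm. 5.2 (ii) dictionary) and `x^N` is fixed by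
`Base(s^trv_N(h'))` for `h' = ((s^⊓_N)^bs)⁻¹ h (s^⊓_N)^bs`, `h ∈ H_{B_N}` (the `H_{A_N}`-fixedness of `f|_{A_N} = f_N^N`, Def. 4.1
(iii)), then `(s^⊓-gp_N(h) · s^⊔-gp_N(h)⁻¹)^N = 1` — `Φ` divisorial, `B` group-like.  (The computation of abc-iut-L6-t12's
`Discharge/Sec4BiKummerRoots.lean`, in the form used level-wise by the tower of roots.)
[cite: MochizukiEtTh2009, Prop 4.3 (iii) p.317 (PDF p.91); §5 p.331 (PDF p.105)] -/
theorem pow_N_eq_one_of_root (h𝔉 : 𝔉.pre = PreFrobenioidData.ofModel Φ B DivB)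
    (hΦd : Objectwise (fun M _ => IsDivisorial M) Φ) (hBg : Objectwise (fun M _ => IsGroupLike M) B)
    (hcap : 𝔉.SgpCapSpec) (hcup : 𝔉.SgpCupSpec) (hstrv : 𝔉.StrvSection) (x : B.obj (op 𝔉.AN.base))
    (hx : x * ModelFrobenioid.unit 𝔉.sCup = ModelFrobenioid.unit 𝔉.sCap)
    (hfix : ∀ hh : 𝔉.HB,
      pull B (ModelFrobenioid.baseMap (𝔉.strv (𝔉.autBaseIsoAB.symm (hh : Aut (𝔉.base.obj 𝔉.BN)))).hom) (x ^ (𝔉.N : ℕ)) =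
        x ^ (𝔉.N : ℕ))
    (hh : 𝔉.HB) :
    (𝔉.sgpCap (hh : Aut (𝔉.base.obj 𝔉.BN)) * (𝔉.sgpCup hh)⁻¹) ^ (𝔉.N : ℕ) = 1 := by
  haveI : IsCancelMul (B.obj (op 𝔉.AN.base)) :=
    isIntegral_iff_isCancelMul.mp (hBg 𝔉.AN.base).isPreDivisorial.isIntegral
  haveI : IsCancelMul (B.obj (op 𝔉.BN.base)) :=
    isIntegral_iff_isCancelMul.mp (hBg 𝔉.BN.base).isPreDivisorial.isIntegral
  have hps : 𝔉.pre.IsPreStep 𝔉.sCap := 𝔉.isPreStep_sCap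
  have hps' : 𝔉.pre.IsPreStep 𝔉.sCup := 𝔉.isPreStep_sCup
  rw [h𝔉] at hps hps'
  haveI : IsIso (ModelFrobenioid.baseMap 𝔉.sCap) := hps.2
  have hb : ModelFrobenioid.baseMap 𝔉.sCap = ModelFrobenioid.baseMap 𝔉.sCup := by
    have e := 𝔉.base_map_sCap
    rw [h𝔉] at e
    exact e
  have hn1 : ModelFrobenioid.degFr 𝔉.sCap = 1 := hps.1
  have hd1 : ModelFrobenioid.degFr 𝔉.sCup = 1 := hps'.1
  set τ := 𝔉.strv (𝔉.autBaseIsoAB.symm (hh : Aut (𝔉.base.obj 𝔉.BN))) with hτ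
  -- units of the two commutation relations
  have e1 := congrArg ModelFrobenioid.unit (hcap (hh : Aut (𝔉.base.obj 𝔉.BN)))
  have e2 := congrArg ModelFrobenioid.unit (hcup hh)
  rw [ModelFrobenioid.unit_comp_of_degFr_eq_one _ (ModelFrobenioid.degFr_eq_one_of_isIso _),
    ModelFrobenioid.unit_comp_pull, hn1, PNat.one_coe, pow_one] at e1
  rw [ModelFrobenioid.unit_comp_of_degFr_eq_one _ (ModelFrobenioid.degFr_eq_one_of_isIso _),
    ModelFrobenioid.unit_comp_pull, hd1, PNat.one_coe, pow_one, ← hb] at e2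
  -- the Kummer-cocycle identity `b^* u₁ · x = τ^* x · b^* u₂`
  have E : pull B (ModelFrobenioid.baseMap 𝔉.sCap) (ModelFrobenioid.unit (𝔉.sgpCap (hh : Aut (𝔉.base.obj 𝔉.BN))).hom) * x =
      pull B (ModelFrobenioid.baseMap τ.hom) x *
        pull B (ModelFrobenioid.baseMap 𝔉.sCap) (ModelFrobenioid.unit (𝔉.sgpCup hh).hom) := by
    apply mul_right_cancel (b := ModelFrobenioid.unit 𝔉.sCup)
    calc pull B (ModelFrobenioid.baseMap 𝔉.sCap) (ModelFrobenioid.unit (𝔉.sgpCap (hh : Aut (𝔉.base.obj 𝔉.BN))).hom) * x *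
            ModelFrobenioid.unit 𝔉.sCup
          = pull B (ModelFrobenioid.baseMap 𝔉.sCap) (ModelFrobenioid.unit (𝔉.sgpCap (hh : Aut (𝔉.base.obj 𝔉.BN))).hom) *
            ModelFrobenioid.unit 𝔉.sCap := by rw [mul_assoc, hx]
      _ = pull B (ModelFrobenioid.baseMap τ.hom) (ModelFrobenioid.unit 𝔉.sCap) * ModelFrobenioid.unit τ.hom := e1
      _ = pull B (ModelFrobenioid.baseMap τ.hom) x *
            (pull B (ModelFrobenioid.baseMap τ.hom) (ModelFrobenioid.unit 𝔉.sCup) * ModelFrobenioid.unit τ.hom) := by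
            rw [← hx, map_mul, mul_assoc]
      _ = pull B (ModelFrobenioid.baseMap τ.hom) x *
            (pull B (ModelFrobenioid.baseMap 𝔉.sCap) (ModelFrobenioid.unit (𝔉.sgpCup hh).hom) * ModelFrobenioid.unit 𝔉.sCup) := by
            rw [← e2]
      _ = _ := by rw [mul_assoc]
  -- its `N`-th power, with `x^N` fixed by `τ`
  have EN := congrArg (fun z => z ^ (𝔉.N : ℕ)) E
  simp only [mul_pow] at EN
  rw [← map_pow, ← map_pow, ← map_pow, hfix hh, mul_comm _ (x ^ (𝔉.N : ℕ))] at EN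
  have hpow : ModelFrobenioid.unit (𝔉.sgpCap (hh : Aut (𝔉.base.obj 𝔉.BN))).hom ^ (𝔉.N : ℕ) =
      ModelFrobenioid.unit (𝔉.sgpCup hh).hom ^ (𝔉.N : ℕ) := by
    apply pull_injective (ModelFrobenioid.baseMap 𝔉.sCap)
    exact mul_left_cancel EN
  -- the difference is a unit, and its rational function is `N`-torsion
  have hsec := 𝔉.sgpCapSection_of hcap hstrv
  have hcs := 𝔉.sgpCupSection_of_spec hcup hstrv
  have hw : 𝔉.sgpCap (hh : Aut (𝔉.base.obj 𝔉.BN)) * (𝔉.sgpCup hh)⁻¹ ∈ 𝔉.units 𝔉.BN := by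
    have h1 := 𝔉.sgpCup_mul_sgpCap_inv_mem_units hsec hcs hh
    have h2 := Subgroup.inv_mem _ h1
    rwa [mul_inv_rev, inv_inv] at h2
  have hw' := 𝔉.mem_modelUnits_of_mem_units h𝔉 hw
  let w' : ModelFrobenioid.units 𝔉.BN := ⟨𝔉.sgpCap (hh : Aut (𝔉.base.obj 𝔉.BN)) * (𝔉.sgpCup hh)⁻¹, hw'⟩
  have hu : ModelFrobenioid.unit (𝔉.sgpCap (hh : Aut (𝔉.base.obj 𝔉.BN)) * (𝔉.sgpCup hh)⁻¹).hom *
      pull B (ModelFrobenioid.baseMap (𝔉.sgpCup hh).inv) (ModelFrobenioid.unit (𝔉.sgpCup hh).hom) =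
      pull B (ModelFrobenioid.baseMap (𝔉.sgpCup hh).inv)
        (ModelFrobenioid.unit (𝔉.sgpCap (hh : Aut (𝔉.base.obj 𝔉.BN))).hom) := by
    have e0 := congrArg ModelFrobenioid.unit (𝔉.sgpCup hh).inv_hom_id
    rw [ModelFrobenioid.unit_comp_of_degFr_eq_one _ (ModelFrobenioid.degFr_eq_one_of_isIso _),
      ModelFrobenioid.unit_id] at e0
    change ModelFrobenioid.unit ((𝔉.sgpCup hh).inv ≫ (𝔉.sgpCap (hh : Aut (𝔉.base.obj 𝔉.BN))).hom) * _ = _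
    rw [ModelFrobenioid.unit_comp_of_degFr_eq_one _ (ModelFrobenioid.degFr_eq_one_of_isIso _), mul_assoc,
      mul_comm (ModelFrobenioid.unit (𝔉.sgpCup hh).inv), e0, mul_one]
  have huN : ModelFrobenioid.unit (𝔉.sgpCap (hh : Aut (𝔉.base.obj 𝔉.BN)) * (𝔉.sgpCup hh)⁻¹).hom ^ (𝔉.N : ℕ) = 1 := by
    have e := congrArg (fun z => z ^ (𝔉.N : ℕ)) hu
    simp only [mul_pow] at e
    rw [← map_pow, ← map_pow, hpow] at e
    exact mul_right_cancel (e.trans (one_mul _).symm)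
  have key : ModelFrobenioid.unitsToRatFn 𝔉.BN (w' ^ (𝔉.N : ℕ)) = ModelFrobenioid.unitsToRatFn 𝔉.BN 1 := by
    rw [map_pow, map_one]
    apply Units.ext
    rw [Units.val_pow_eq_pow_val, ModelFrobenioid.coe_unitsToRatFn, Units.val_one]
    exact huN
  have hwN := ModelFrobenioid.unitsToRatFn_injective (hΦd 𝔉.BN.base).isPreDivisorial.isIntegral key
  have hfin : ((w' ^ (𝔉.N : ℕ) : ModelFrobenioid.units 𝔉.BN) : Aut 𝔉.BN) =
      ((1 : ModelFrobenioid.units 𝔉.BN) : Aut 𝔉.BN) := congrArg Subtype.val hwN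
  rw [Subgroup.coe_pow, Subgroup.coe_one] at hfin
  exact hfin

/-- **`BiKummerDifferenceMem`, generic model form** (Prop. 4.3 (iii), p.317 (PDF p.91)): under the hypotheses of
`pow_N_eq_one_of_root` for every `h ∈ H_{B_N}`, the difference `s^⊔-gp_N(h)·s^⊓-gp_N(h)⁻¹` lies in `μ_N(B_N)`.
[cite: MochizukiEtTh2009, Prop 4.3 (iii) p.317 (PDF p.91); §5 p.331 (PDF p.105)] -/
theorem biKummerDifferenceMem_of_root (h𝔉 : 𝔉.pre = PreFrobenioidData.ofModel Φ B DivB)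
    (hΦd : Objectwise (fun M _ => IsDivisorial M) Φ) (hBg : Objectwise (fun M _ => IsGroupLike M) B)
    (hcap : 𝔉.SgpCapSpec) (hcup : 𝔉.SgpCupSpec) (hstrv : 𝔉.StrvSection) (x : B.obj (op 𝔉.AN.base))
    (hx : x * ModelFrobenioid.unit 𝔉.sCup = ModelFrobenioid.unit 𝔉.sCap)
    (hfix : ∀ hh : 𝔉.HB,
      pull B (ModelFrobenioid.baseMap (𝔉.strv (𝔉.autBaseIsoAB.symm (hh : Aut (𝔉.base.obj 𝔉.BN)))).hom) (x ^ (𝔉.N : ℕ)) =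
        x ^ (𝔉.N : ℕ)) :
    𝔉.BiKummerDifferenceMem := by
  rw [biKummerDifferenceMem_iff]
  intro hh
  exact ⟨by
    have h1 := 𝔉.sgpCup_mul_sgpCap_inv_mem_units (𝔉.sgpCapSection_of hcap hstrv) (𝔉.sgpCupSection_of_spec hcup hstrv) hh
    have h2 := Subgroup.inv_mem _ h1
    rwa [mul_inv_rev, inv_inv] at h2,
    𝔉.pow_N_eq_one_of_root h𝔉 hΦd hBg hcap hcup hstrv x hx hfix hh⟩

end ThetaFrobenioid

end Literature.AnabelianGeometry.EtaleTheta

end
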